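import Summits.MatrixMultiplication.OmegaCensus.STPP222SqNone_2_2_5A

/-!
# ω-census, the pattern `(2,2,2)²`: NOT in `ZMod 2 × ZMod 2 × ZMod 5` — search chunks, part D

HONEST FRAMING (pub-omega census; verbatim): lottery ticket; floor = certified bounds/negative ranges.
Census STRUCTURE bookkeeping (Q7 row `k = 2`), not progress on `ω`.  Kernel search chunks 15–17 of 18 for
`STPP222SqNone_2_2_5.lean` (data `E2_2_5` / `el2_2_5` from part A; method in part A's docstring).
-/

open Literature.Computability.AlgebraicComplexity Finset

namespace Summit.MatrixMultiplication.OmegaCensus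

namespace STPP222SqNeg

/-- Start triples, chunk 15 (3 starts, 28312 clause evaluations). [folklore] -/
def reps2_2_5_15 : List ((ℕ × ℕ × ℕ) × (ℕ × ℕ × ℕ) × (ℕ × ℕ × ℕ) × List (ℕ × ℕ × ℕ)) :=
  [((0, 1, 1), (0, 1, 2), (1, 0, 2), el2_2_5), ((0, 1, 1), (1, 0, 0), (1, 0, 1), el2_2_5), ((0, 1, 1), (1, 0, 0), (1, 0, 2), el2_2_5)]

/-- Kernel search, chunk 15. [folklore] -/
theorem search2_2_5_15 : searchB E2_2_5.ops el2_2_5 E2_2_5.key reps2_2_5_15 = true := by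
  decide +kernel

/-- Start triples, chunk 16 (1 starts, 49617 clause evaluations). [folklore] -/
def reps2_2_5_16 : List ((ℕ × ℕ × ℕ) × (ℕ × ℕ × ℕ) × (ℕ × ℕ × ℕ) × List (ℕ × ℕ × ℕ)) :=
  [((0, 1, 1), (1, 0, 0), (1, 1, 0), [(0, 0, 0), (0, 0, 1), (0, 0, 2), (0, 0, 3), (0, 0, 4), (0, 1, 0), (0, 1, 1), (0, 1, 2), (0, 1, 3), (0, 1, 4), (1, 0, 0), (1, 0, 1), (1, 0, 2)])]

/-- Kernel search, chunk 16. [folklore] -/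
theorem search2_2_5_16 : searchB E2_2_5.ops el2_2_5 E2_2_5.key reps2_2_5_16 = true := by
  decide +kernel

/-- Start triples, chunk 17 (4 starts, 26927 clause evaluations). [folklore] -/
def reps2_2_5_17 : List ((ℕ × ℕ × ℕ) × (ℕ × ℕ × ℕ) × (ℕ × ℕ × ℕ) × List (ℕ × ℕ × ℕ)) :=
  [((0, 1, 1), (1, 0, 0), (1, 1, 0), [(1, 0, 3), (1, 0, 4), (1, 1, 0), (1, 1, 1), (1, 1, 2), (1, 1, 3), (1, 1, 4)]), ((0, 1, 1), (1, 0, 0), (1, 1, 2), el2_2_5), ((0, 1, 1), (1, 0, 1), (1, 0, 2), el2_2_5), ((0, 1, 1), (1, 0, 1), (1, 1, 1), el2_2_5)]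

/-- Kernel search, chunk 17. [folklore] -/
theorem search2_2_5_17 : searchB E2_2_5.ops el2_2_5 E2_2_5.key reps2_2_5_17 = true := by
  decide +kernel

end STPP222SqNeg

end Summit.MatrixMultiplication.OmegaCensus
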